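import Mathlib
import Literature.NumberTheory.GaloisRepresentations.CubicReciprocityRationalPrime
import Summits.Langlands.Langlands.Theorems.PicardMuOrdinaryResidualAutomorphyEvenHypotheses

/-!
# The cubic resolvent field `E` is a CM field (Stage B1 of `ResidualAutomorphyEven`, part 1)

Helper file for item stmt-Langlands-13760 (route `PicardMuOrdinary`).  The element
`t = r₀ r₁ + r₂ r₃ ∈ M` (a root of the cubic resolvent of `f`) is fixed by the stabiliser `H` of the
pairing `{01|23}`, so lies in `E = M^H` (`tM_mem_E`); its three conjugates `r₀r₁ + r₂r₃`,
`r₀r₂ + r₁r₃`, `r₀r₃ + r₁r₂` are pairwise distinct (`tM_ne` — differences factor as products of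
root differences).  This is the first step towards: `E = ℚ(t)(ω)` with `ℚ(t)` totally real (all roots of
`f` are real) and `E` totally complex, i.e. `E` is CM — whence (Weil, proved in the tree as
`HeckeCharacter.exists_isUnitary_hasUnitaryArchType_of_congruence`) Hecke characters of `E` of every
even unitary archimedean type exist.  Unconditional.
-/

set_option linter.dupNamespace false -- project-wide option (lakefile weak.linter.dupNamespace); `Summit.Langlands.Langlands` is the mandated namespace

noncomputable section

namespace Summit.Langlands.Langlands.Theorems.ResidualAutomorphyEven

open Polynomial Equiv Finset NumberField Pairing
open scoped Classical

variable {f : ℤ[X]} (h : IsSepQuartic f)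

/-! ### `t = r₀ r₁ + r₂ r₃` and its invariance under the stabiliser of the pairing `{01|23}` -/

/-- The stabiliser of the pairing `0 = {01|23}` in `S₄` preserves the partition `{{0,1},{2,3}}`
(finite check). -/
theorem blocks_of_act_eq_zero : ∀ σ : Perm (Fin 4), act σ 0 = 0 →
    (((σ 0 = 0 ∧ σ 1 = 1) ∨ (σ 0 = 1 ∧ σ 1 = 0)) ∧ ((σ 2 = 2 ∧ σ 3 = 3) ∨ (σ 2 = 3 ∧ σ 3 = 2))) ∨
    (((σ 0 = 2 ∧ σ 1 = 3) ∨ (σ 0 = 3 ∧ σ 1 = 2)) ∧ ((σ 2 = 0 ∧ σ 3 = 1) ∨ (σ 2 = 1 ∧ σ 3 = 0))) := by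
  decide +kernel

/-- **`r_{σ0} r_{σ1} + r_{σ2} r_{σ3} = r₀ r₁ + r₂ r₃` for `σ` in the stabiliser of `{01|23}`**, in any
commutative ring. -/
theorem pairSum_eq_of_act_eq_zero {R : Type*} [CommRing R] (r : Fin 4 → R) {σ : Perm (Fin 4)}
    (hσ : act σ 0 = 0) : r (σ 0) * r (σ 1) + r (σ 2) * r (σ 3) = r 0 * r 1 + r 2 * r 3 := by
  rcases blocks_of_act_eq_zero σ hσ with ⟨h01 | h01, h23 | h23⟩ | ⟨h01 | h01, h23 | h23⟩ <;>
    (simp only [h01.1, h01.2, h23.1, h23.2]; try ring)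

/-- `t = r₀ r₁ + r₂ r₃ ∈ M`, a root of the cubic resolvent of `f`. -/
def tM (h : IsSepQuartic f) : M f := rt h 0 * rt h 1 + rt h 2 * rt h 3

/-- `t` is fixed by the stabiliser `H` of the pairing `{01|23}`. -/
theorem smul_tM_of_mem {g : G f} (hg : g ∈ stabPairing h) : g (tM h) = tM h := by
  rw [mem_stabPairing] at hg
  rw [tM, map_add, map_mul, map_mul, smul_rt, smul_rt, smul_rt, smul_rt]
  exact pairSum_eq_of_act_eq_zero (rt h) hg

/-- `t ∈ E = M^H`. -/
theorem tM_mem_E : tM h ∈ E h :=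
  (IntermediateField.mem_fixedField_iff _ _).mpr fun _ hg => smul_tM_of_mem h hg

/-- `t` as an element of `E`. -/
def tE (h : IsSepQuartic f) : E h := ⟨tM h, tM_mem_E h⟩

/-- The three values of `r_{σ0} r_{σ1} + r_{σ2} r_{σ3}`: by the pairing `σ⁻¹ · 0`... concretely, the
conjugates of `t` are `r₀r₁ + r₂r₃`, `r₀r₂ + r₁r₃`, `r₀r₃ + r₁r₂`, with pairwise differences
`(r₀ - r₃)(r₁ - r₂)`, `(r₀ - r₂)(r₁ - r₃)`, `(r₀ - r₁)(r₂ - r₃)` — non-zero for distinct roots. -/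
theorem conj_tM_sub {R : Type*} [CommRing R] (r : Fin 4 → R) :
    (r 0 * r 1 + r 2 * r 3) - (r 0 * r 2 + r 1 * r 3) = (r 0 - r 3) * (r 1 - r 2) ∧
    (r 0 * r 1 + r 2 * r 3) - (r 0 * r 3 + r 1 * r 2) = (r 0 - r 2) * (r 1 - r 3) ∧
    (r 0 * r 2 + r 1 * r 3) - (r 0 * r 3 + r 1 * r 2) = (r 0 - r 1) * (r 2 - r 3) := by
  refine ⟨by ring, by ring, by ring⟩

/-! ### The conjugates of `t` -/

/-- `g t = r_{σ0} r_{σ1} + r_{σ2} r_{σ3}` for `σ = perm4 g`. -/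
theorem smul_tM (g : G f) :
    g (tM h) = rt h (perm4 h g 0) * rt h (perm4 h g 1) + rt h (perm4 h g 2) * rt h (perm4 h g 3) := by
  rw [tM, map_add, map_mul, map_mul, smul_rt, smul_rt, smul_rt, smul_rt]

/-- The even permutations `c₁ = (1 2 3)` and `c₂ = (1 3 2)` (as products of transpositions). -/
def c1 : Perm (Fin 4) := Equiv.swap 1 2 * Equiv.swap 2 3

/-- See `c1`. -/
def c2 : Perm (Fin 4) := Equiv.swap 2 3 * Equiv.swap 1 2

/-- Values of `c₁`, `c₂` and their signs (finite check). -/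
theorem c1_c2_spec : (c1 0 = 0 ∧ c1 1 = 2 ∧ c1 2 = 3 ∧ c1 3 = 1 ∧ Perm.sign c1 = 1) ∧
    (c2 0 = 0 ∧ c2 1 = 3 ∧ c2 2 = 1 ∧ c2 3 = 2 ∧ Perm.sign c2 = 1) := by
  decide +kernel

/-- **The three conjugates `t = r₀r₁ + r₂r₃`, `t′ = r₀r₂ + r₃r₁`, `t″ = r₀r₃ + r₁r₂` of `t` are values of
`K`-automorphisms of `M` at `t`** (`12 ∣ #G`: `A₄ ≤ perm4(G)`). -/
theorem exists_smul_tM_eq (h12 : 12 ∣ Nat.card (G f)) :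
    (∃ g : G f, g (tM h) = rt h 0 * rt h 2 + rt h 3 * rt h 1) ∧
    (∃ g : G f, g (tM h) = rt h 0 * rt h 3 + rt h 1 * rt h 2) := by
  obtain ⟨⟨h10, h11, h12', h13, hs1⟩, ⟨h20, h21, h22, h23, hs2⟩⟩ := c1_c2_spec
  constructor
  · obtain ⟨g, hg⟩ := exists_perm4_eq h h12 c1 hs1
    exact ⟨g, by rw [smul_tM, hg, h10, h11, h12', h13]⟩
  · obtain ⟨g, hg⟩ := exists_perm4_eq h h12 c2 hs2
    exact ⟨g, by rw [smul_tM, hg, h20, h21, h22, h23]⟩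

/-- The three conjugates of `t` are pairwise distinct (the roots `rᵢ` are distinct). -/
theorem tM_conj_ne :
    tM h ≠ rt h 0 * rt h 2 + rt h 3 * rt h 1 ∧ tM h ≠ rt h 0 * rt h 3 + rt h 1 * rt h 2 ∧
      rt h 0 * rt h 2 + rt h 3 * rt h 1 ≠ rt h 0 * rt h 3 + rt h 1 * rt h 2 := by
  have hinj := rt_injective h
  have hne : ∀ i j : Fin 4, i ≠ j → rt h i - rt h j ≠ 0 := fun i j hij =>
    sub_ne_zero.mpr fun heq => hij (hinj heq)
  obtain ⟨e1, e2, e3⟩ := conj_tM_sub (rt h)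
  refine ⟨fun heq => ?_, fun heq => ?_, fun heq => ?_⟩
  · rw [tM] at heq
    have : (rt h 0 - rt h 3) * (rt h 1 - rt h 2) = 0 := by rw [← e1]; linear_combination heq
    exact (mul_ne_zero (hne 0 3 (by decide)) (hne 1 2 (by decide))) this
  · rw [tM] at heq
    have : (rt h 0 - rt h 2) * (rt h 1 - rt h 3) = 0 := by rw [← e2]; linear_combination heq
    exact (mul_ne_zero (hne 0 2 (by decide)) (hne 1 3 (by decide))) this
  · have : (rt h 0 - rt h 1) * (rt h 2 - rt h 3) = 0 := by rw [← e3]; linear_combination heq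
    exact (mul_ne_zero (hne 0 1 (by decide)) (hne 2 3 (by decide))) this

/-! ### All roots of `f` are real under every complex embedding of `M` -/

/-- **Under any embedding `Φ : M → ℂ` the roots `Φ(rᵢ)` are real**, granted that `f` has four real
roots: `f ⊗ ℝ` splits, so the complex roots of `f` are the images of the real ones. -/
theorem conj_apply_rt (hdeg : f.natDegree = 4) (hreal : (f.map (Int.castRingHom ℝ)).roots.card = 4)
    (Φ : M f →+* ℂ) (i : Fin 4) : starRingEnd ℂ (Φ (rt h i)) = Φ (rt h i) := by
  have hf0 : f.map (Int.castRingHom ℂ) ≠ 0 := by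
    intro h0
    have := congrArg natDegree h0
    rw [natDegree_map_eq_of_injective (Int.castRingHom ℂ).injective_int, hdeg, natDegree_zero] at this
    exact absurd this (by norm_num)
  -- `Φ rᵢ` is a root of `f ⊗ ℂ`
  have hroot : Φ (rt h i) ∈ (f.map (Int.castRingHom ℂ)).roots := by
    rw [mem_roots hf0, IsRoot.def, eval_map]
    have h1 := congrArg Φ (aeval_rt h i)
    rw [aeval_def, hom_eval₂, map_zero, RingHom.ext_int (Φ.comp (algebraMap ℤ (M f))) (Int.castRingHom ℂ)] at h1
    exact h1
  -- the complex roots of `f` are the images of its four real roots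
  have hcard : (f.map (Int.castRingHom ℝ)).roots.card = (f.map (Int.castRingHom ℝ)).natDegree := by
    rw [hreal, natDegree_map_eq_of_injective (Int.castRingHom ℝ).injective_int, hdeg]
  have hmap : (f.map (Int.castRingHom ℝ)).map (algebraMap ℝ ℂ) = f.map (Int.castRingHom ℂ) := by
    rw [Polynomial.map_map, RingHom.ext_int ((algebraMap ℝ ℂ).comp (Int.castRingHom ℝ)) (Int.castRingHom ℂ)]
  rw [← hmap, ← roots_map_of_injective_of_card_eq_natDegree (algebraMap ℝ ℂ).injective hcard,
    Multiset.mem_map] at hroot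
  obtain ⟨x, -, hx⟩ := hroot
  rw [← hx]
  exact Complex.conj_ofReal x

/-- **`Φ(t)` is real** under any embedding `Φ : M → ℂ`. -/
theorem conj_apply_tM (hdeg : f.natDegree = 4) (hreal : (f.map (Int.castRingHom ℝ)).roots.card = 4)
    (Φ : M f →+* ℂ) : starRingEnd ℂ (Φ (tM h)) = Φ (tM h) := by
  simp only [tM, map_add, map_mul, conj_apply_rt h hdeg hreal Φ]

/-- **`φ(t)` is real under any embedding `φ : E → ℂ`** (extend `φ` to `M`, `ℂ` being algebraically
closed). -/
theorem conj_apply_tE (hdeg : f.natDegree = 4) (hreal : (f.map (Int.castRingHom ℝ)).roots.card = 4)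
    (φ : E h →+* ℂ) : starRingEnd ℂ (φ (tE h)) = φ (tE h) := by
  letI : Algebra (E h) ℂ := φ.toAlgebra
  haveI : Module.IsTorsionFree (E h) ℂ := DivisionSemiring.to_moduleIsTorsionFree
  haveI : Module.IsTorsionFree (E h) (M f) := DivisionSemiring.to_moduleIsTorsionFree
  haveI : Algebra.IsAlgebraic (E h) (M f) := Algebra.IsAlgebraic.of_finite (E h) (M f)
  let Φ : M f →ₐ[E h] ℂ := IsAlgClosed.lift
  have hΦ : Φ (tM h) = φ (tE h) := by
    have := Φ.commutes (tE h)
    exact this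
  rw [← hΦ]
  exact conj_apply_tM h hdeg hreal Φ.toRingHom

/-- `t` lies in the maximal real subfield of `E`. -/
theorem tE_mem_maximalRealSubfield (hdeg : f.natDegree = 4) (hreal : (f.map (Int.castRingHom ℝ)).roots.card = 4) :
    tE h ∈ NumberField.maximalRealSubfield (E h) :=
  (NumberField.mem_maximalRealSubfield_iff _).mpr fun φ => conj_apply_tE h hdeg hreal φ

/-! ### Degrees: `[E : ℚ] = 6`, `[ℚ(t) : ℚ] ≥ 3` -/

/-- `[E : ℚ] = 6`. -/
theorem finrank_rat_E (h12 : 12 ∣ Nat.card (G f)) : Module.finrank ℚ (E h) = 6 := by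
  haveI : IsCyclotomicExtension {3} ℚ (CyclotomicField 3 ℚ) := CyclotomicField.isCyclotomicExtension 3 ℚ
  rw [← Module.finrank_mul_finrank ℚ K (E h),
    Literature.NumberTheory.GaloisRepresentations.finrank_eq_two_of_isCyclotomicExtension_three (K := K),
    finrank_E h h12]

/-- **`t` has at least three conjugates over `ℚ`**: `3 ≤ deg minpoly_ℚ(t)`. -/
theorem three_le_natDegree_minpoly_tM (h12 : 12 ∣ Nat.card (G f)) : 3 ≤ (minpoly ℚ (tM h)).natDegree := by
  set P := minpoly ℚ (tM h) with hP
  have hint : IsIntegral ℚ (tM h) := IsIntegral.of_finite ℚ _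
  have hP0 : P.map (algebraMap ℚ (M f)) ≠ 0 := (Polynomial.map_ne_zero_iff (algebraMap ℚ (M f)).injective).mpr
    (minpoly.ne_zero hint)
  -- the three conjugates are roots of `P`
  have hroot : ∀ g : G f, g (tM h) ∈ (P.map (algebraMap ℚ (M f))).roots := by
    intro g
    rw [mem_roots hP0, IsRoot.def, eval_map, ← aeval_def,
      show g (tM h) = ((g : M f ≃ₐ[K] M f).toAlgHom.restrictScalars ℚ) (tM h) from rfl,
      Polynomial.aeval_algHom_apply, minpoly.aeval, map_zero]
  obtain ⟨⟨g₁, hg₁⟩, ⟨g₂, hg₂⟩⟩ := exists_smul_tM_eq h h12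
  obtain ⟨hne1, hne2, hne3⟩ := tM_conj_ne h
  have h1 : tM h ∈ (P.map (algebraMap ℚ (M f))).roots := by
    have := hroot 1; rwa [AlgEquiv.one_apply] at this
  have h2 := hroot g₁
  have h3 := hroot g₂
  rw [hg₁] at h2
  rw [hg₂] at h3
  have hsub : ({tM h, rt h 0 * rt h 2 + rt h 3 * rt h 1, rt h 0 * rt h 3 + rt h 1 * rt h 2} : Multiset (M f)) ≤
      (P.map (algebraMap ℚ (M f))).roots := by
    refine (Multiset.le_iff_subset ?_).mpr ?_
    · simp only [Multiset.insert_eq_cons, Multiset.nodup_cons, Multiset.mem_cons, Multiset.mem_singleton,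
        Multiset.nodup_singleton, and_true, not_or]
      exact ⟨⟨hne1, hne2⟩, hne3⟩
    · intro x hx
      simp only [Multiset.insert_eq_cons, Multiset.mem_cons, Multiset.mem_singleton] at hx
      rcases hx with rfl | rfl | rfl
      exacts [h1, h2, h3]
  have hcard := Multiset.card_le_card hsub
  simp only [Multiset.insert_eq_cons, Multiset.card_cons, Multiset.card_singleton] at hcard
  have hdeg := Polynomial.card_roots' (P.map (algebraMap ℚ (M f)))
  rw [natDegree_map] at hdeg
  omega

/-- `minpoly_ℚ(t)` computed in `E` or in `M` is the same polynomial. -/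
theorem minpoly_tE : minpoly ℚ (tE h) = minpoly ℚ (tM h) := by
  have := minpoly.algHom_eq ((IntermediateField.val (E h)).restrictScalars ℚ)
    (by exact Subtype.val_injective) (tE h)
  exact this.symm

/-! ### `E` is a CM field: `E = ℚ(t)(ω)`, `ℚ(t)` totally real, `[E : ℚ(t)] = 2` -/

/-- The subfield `ℚ(t) ⊆ E`. -/
def F0 (h : IsSepQuartic f) : IntermediateField ℚ (E h) := IntermediateField.adjoin ℚ {tE h}

/-- `ℚ(t)` is contained in the maximal real subfield of `E`. -/
theorem F0_le_maximalRealSubfield (hdeg : f.natDegree = 4) (hreal : (f.map (Int.castRingHom ℝ)).roots.card = 4) :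
    (F0 h).toSubfield ≤ NumberField.maximalRealSubfield (E h) := by
  show Subfield.closure (Set.range (algebraMap ℚ (E h)) ∪ {tE h}) ≤ _
  refine Subfield.closure_le.mpr ?_
  rintro x (⟨q, rfl⟩ | hx)
  · refine (NumberField.mem_maximalRealSubfield_iff _).mpr fun φ => ?_
    have h1 : φ (algebraMap ℚ (E h) q) = (q : ℂ) := by rw [← RingHom.comp_apply, eq_ratCast]
    show starRingEnd ℂ (φ (algebraMap ℚ (E h) q)) = φ (algebraMap ℚ (E h) q)
    rw [h1, ← Complex.ofReal_ratCast, Complex.conj_ofReal]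
  · rw [Set.mem_singleton_iff] at hx
    subst hx
    exact tE_mem_maximalRealSubfield h hdeg hreal

/-- Every element of `ℚ(t)` is real under every embedding of `E`. -/
theorem conj_apply_of_mem_F0 (hdeg : f.natDegree = 4) (hreal : (f.map (Int.castRingHom ℝ)).roots.card = 4)
    {x : E h} (hx : x ∈ F0 h) (φ : E h →+* ℂ) : starRingEnd ℂ (φ x) = φ x :=
  (NumberField.mem_maximalRealSubfield_iff x).mp (F0_le_maximalRealSubfield h hdeg hreal hx) φ

/-- **`ℚ(t)` is totally real.** -/
theorem isTotallyReal_F0 (hdeg : f.natDegree = 4) (hreal : (f.map (Int.castRingHom ℝ)).roots.card = 4) :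
    IsTotallyReal (F0 h) := by
  refine ⟨fun w => ?_⟩
  obtain ⟨W, rfl⟩ := NumberField.InfinitePlace.comap_surjective (K := E h) w
  show (W.comap (algebraMap (F0 h) (E h))).IsReal
  rw [← NumberField.InfinitePlace.mk_embedding W, NumberField.InfinitePlace.comap_mk,
    NumberField.InfinitePlace.isReal_mk_iff]
  -- `W.embedding ∘ (ℚ(t) ↪ E)` is fixed by complex conjugation
  refine RingHom.ext fun x => ?_
  simp only [NumberField.ComplexEmbedding.conjugate_coe_eq, RingHom.comp_apply]
  exact conj_apply_of_mem_F0 h hdeg hreal x.2 W.embedding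

/-- **`E` is totally complex** (it contains `K = ℚ(ω)`). -/
theorem isTotallyComplex_E : IsTotallyComplex (E h) := by
  haveI : IsCyclotomicExtension {3} ℚ (CyclotomicField 3 ℚ) := CyclotomicField.isCyclotomicExtension 3 ℚ
  haveI : IsTotallyComplex K := IsCyclotomicExtension.Rat.isTotallyComplex K (n := 3) (by norm_num)
  exact isTotallyComplex_of_algebra K (E h)

/-- **`[E : ℚ(t)] = 2`** (`[E:ℚ] = 6`, `[ℚ(t):ℚ] ≥ 3`, and `E ≠ ℚ(t)` as `E` is totally complex). -/
theorem finrank_F0_E (h12 : 12 ∣ Nat.card (G f)) (hdeg : f.natDegree = 4)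
    (hreal : (f.map (Int.castRingHom ℝ)).roots.card = 4) : Module.finrank (F0 h) (E h) = 2 := by
  have hint : IsIntegral ℚ (tE h) := IsIntegral.of_finite ℚ _
  have hF : Module.finrank ℚ (F0 h) = (minpoly ℚ (tE h)).natDegree := IntermediateField.adjoin.finrank hint
  have h3 : 3 ≤ Module.finrank ℚ (F0 h) := by
    rw [hF, minpoly_tE]; exact three_le_natDegree_minpoly_tM h h12
  have htower := Module.finrank_mul_finrank ℚ (F0 h) (E h)
  rw [finrank_rat_E h h12] at htower
  have hpos : 0 < Module.finrank (F0 h) (E h) := Module.finrank_pos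
  -- `[E : ℚ(t)] ≠ 1`: otherwise `E = ℚ(t)` would be totally real
  have hne1 : Module.finrank (F0 h) (E h) ≠ 1 := by
    intro h1
    rw [h1, mul_one] at htower
    have htop : F0 h = ⊤ := IntermediateField.eq_of_le_of_finrank_eq le_top
      (by rw [IntermediateField.finrank_top', finrank_rat_E h h12, htower])
    haveI := isTotallyReal_F0 h hdeg hreal
    haveI : IsTotallyReal (E h) := by
      rw [htop] at this
      exact IsTotallyReal.ofRingEquiv (IntermediateField.topEquiv (F := ℚ) (E := E h)).toRingEquiv
    haveI := isTotallyComplex_E h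
    obtain ⟨w⟩ := (inferInstance : Nonempty (NumberField.InfinitePlace (E h)))
    exact NumberField.InfinitePlace.not_isReal_iff_isComplex.mpr (IsTotallyComplex.isComplex w) (IsTotallyReal.isReal w)
  -- so `[E : ℚ(t)] = 2`
  have hle : Module.finrank (F0 h) (E h) ≤ 2 := by nlinarith
  omega

/-- **`E` is a CM field.** -/
theorem isCMField_E (h12 : 12 ∣ Nat.card (G f)) (hdeg : f.natDegree = 4)
    (hreal : (f.map (Int.castRingHom ℝ)).roots.card = 4) : NumberField.IsCMField (E h) := by
  haveI := isTotallyReal_F0 h hdeg hreal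
  haveI := isTotallyComplex_E h
  haveI : Module.Free (F0 h) (E h) := Module.Free.of_divisionRing (F0 h) (E h)
  haveI : Algebra.IsQuadraticExtension (F0 h) (E h) := { finrank_eq_two' := finrank_F0_E h h12 hdeg hreal }
  exact NumberField.IsCMField.ofCMExtension (F0 h) (E h)

end Summit.Langlands.Langlands.Theorems.ResidualAutomorphyEven
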